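import Summits.CriticalPhenomena.PercolationContinuityZ3.Theorems.PercNearOneGluingNoHeavyQuantGluedCheapPool
import HarnessLib

/-!
# QUANT lane R8, T-DEC: LEMMA W's pair condition in the EASY configurations — the top copy of the low atom above the layer, or the low atom
# self-sufficient for the glued piece (`T ≤ 2l + m`) — no cheapness needed (arm-1 gen 59, architect)

builds on p205010 (kernel theorem, internal audit signed; external expert review pending)

Support file (`--supports stmt-CriticalPhenomena-4575`), QUANT lane seat prim-quant-arm-1 (gen 59); memo `run/shared/lean/prim/quant/prim-quant-arm-1-g59/ARCH-G59.md`
§0 (4).  Theorems only; standard axioms, no sorries, no definitions.  Complements the six low-triple cell theorems (`…QuantGluedWindowLight`, `…HeavyLow`,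
`…Incompat`, `…IncompatTwo`, `…IncompatHeavy`, `…HeavyHeavy`): for a light window pair `(l, h)` and ANY price system `(α, p)` of the image at `(y, T, j)`,
`(1−γ)Ψ(l) + γΨ(h) ≤ 0` holds (i) when `j < l + r + k` — the top copy of `l` is a giant and absorbs the two lower copies at the floor rate, `y ≤ qg`
(**`gluedPullback_windowPair_topGiant`**), and (ii) when `T ≤ 2l + m` (e.g. `2(l+r) ≥ T`, as `2r < m`) — then `Ψ(l) ≤ 0` by arm-1 g58's absorber half
`gluedPullback_nonpos` (**`gluedPullback_windowPair_selfSufficient`**); in both cases `Ψ(h) ≤ 0` because `h` is a window atom.  What then remains of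
LEMMA W's pair condition is exactly the TWO-ROW regime `2(l+r) < T ≤ 2(l+r+k)`, `l+r+k ≤ j`, `T > 2l + m` (memo §4).

HONEST STATUS.  `GluedLemmaW` (flow form), `GluedDominatedMass`, the band, `SiblingStep`, `FarTreeRow` OPEN; RATE class (log\*) / honest sentence of
`run/shared/lean/prim/quant/README.md` unchanged.  [this work].  Nothing here is cited as a published result.  The gluing rows served
[cite: KozmaNitzan2024, Conjecture 3 (p. 15)]; product measure [cite: Grimmett1999, §1.3 p. 10].
-/

noncomputable section

open scoped BigOperators

namespace Summit.CriticalPhenomena.PercolationContinuityZ3.Theorems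
namespace Quant

open Finset

namespace LawDec

/-- **LEMMA W's pair condition when the top copy of the low atom lies above the layer** (`j < l + r + k`): for every price system at `(y, T, j)`
(`y = ax ≤ qg`, `T = a(S+m)`), a light pair `(l, h)` with `l < h ≤ B`, `j < h + r + k` has `(1−γ)Ψ(l) + γΨ(h) ≤ 0` — the lower copies of `l` ride its own top
copy (`y ≤ qg`), and `Ψ(h) ≤ 0` (`gluedPullback_nonpos`). [this work] -/
theorem gluedPullback_windowPair_topGiant (x a q g S : ℝ) (B r k j l h : ℕ) (α p : ℕ → ℝ)
    (hx0 : 0 < x) (hx1 : x < 1) (ha0 : 0 < a) (ha1 : a ≤ 1) (hq0 : 0 < q) (hq1 : q < 1) (hg0 : 0 ≤ g) (hg1 : g ≤ 1) (hr : 1 ≤ r)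
    (hxqg : x ≤ q * g) (hjM : j < B + (r + k)) (hlh : l < h) (hhB : h ≤ B) (hwin : j < h + r + k)
    (hlow : 2 * (l : ℝ) < a * S) (hlight : pairGate (a * x) (a * S) l h < a * x) (htop : j < l + r + k)
    (hp : ∀ h, 0 ≤ p h)
    (hαp : ∀ l' h', l' ≤ j → 2 * (l' : ℝ) < a * (S + q * ((r : ℝ) + k * g)) → h' ≤ B + (r + k) →
      (j + 1 ≤ h' ∨ a * (S + q * ((r : ℝ) + k * g)) < (l' : ℝ) + h') →
      α l' ≤ usage (a * x) (a * (S + q * ((r : ℝ) + k * g))) j l' h' * p h') :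
    (1 - pairGate (a * x) (a * S) l h) * gluedPullback (a * (S + q * ((r : ℝ) + k * g))) q g j r k α p l
      + pairGate (a * x) (a * S) l h * gluedPullback (a * (S + q * ((r : ℝ) + k * g))) q g j r k α p h ≤ 0 := by
  set y : ℝ := a * x with hy
  set T : ℝ := a * (S + q * ((r : ℝ) + k * g)) with hT
  clear_value y T
  have hy0 : 0 < y := by rw [hy]; exact mul_pos ha0 hx0
  have hyx : y ≤ x := by rw [hy]; nlinarith
  have hy1 : y < 1 := by linarith
  have hyqg : y ≤ q * g := le_trans hyx hxqg
  have haff : y * ((r : ℝ) + k) ≤ q * ((r : ℝ) + k * g) := by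
    have h1 : q * g * ((r : ℝ) + k) ≤ q * ((r : ℝ) + k * g) := by
      have : q * g * (r : ℝ) ≤ q * r := by nlinarith [mul_le_mul_of_nonneg_left hg1 (mul_nonneg hq0.le (Nat.cast_nonneg r))]
      nlinarith
    nlinarith [mul_le_mul_of_nonneg_right hyqg (show (0:ℝ) ≤ (r : ℝ) + k by positivity)]
  have hγ0 : 0 < pairGate y (a * S) l h := pairGate_pos y (a * S) l h hlow hlh
  have hγ1 : pairGate y (a * S) l h < 1 := lt_trans hlight hy1
  -- Ψ(h) ≤ 0: window atom
  have hΨh : gluedPullback T q g j r k α p h ≤ 0 :=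
    gluedPullback_nonpos y q g T r k j B h α p hy0 hy1 hq0 hq1.le hg0 hg1 hr hyqg haff hjM hhB (Or.inr hwin) hp hαp
  -- Ψ(l) ≤ 0: the two lower copies ship to the top copy l + r + k > j
  have hT2l : 2 * (l : ℝ) < T := by
    rw [hT]; nlinarith [mul_nonneg ha0.le (show (0:ℝ) ≤ q * ((r:ℝ) + k * g) by positivity)]
  have hlB : l + r + k ≤ B + (r + k) := by omega
  have c0 : coefAt T j α p l ≤ y / (1 - y) * p (l + r + k) :=
    coefAt_le_giant y T j (B + (r + k)) α p hy0 hy1 hp hαp l (l + r + k) (by omega) hlB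
  have c1 : coefAt T j α p (l + r) ≤ y / (1 - y) * p (l + r + k) :=
    coefAt_le_giant y T j (B + (r + k)) α p hy0 hy1 hp hαp (l + r) (l + r + k) (by omega) hlB
  have c2 : coefAt T j α p (l + r + k) = -p (l + r + k) := by
    have : ¬ (l + r + k ≤ j ∧ 2 * ((l + r + k : ℕ) : ℝ) < T) := fun hh => by omega
    simp only [coefAt, if_neg this]
  have hΨl : gluedPullback T q g j r k α p l ≤ 0 := by
    unfold gluedPullback
    rw [c2]
    have t0 : 0 ≤ 1 - q := by linarith
    have t1 : 0 ≤ q * (1 - g) := mul_nonneg hq0.le (by linarith)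
    have h1y : 0 < 1 - y := by linarith
    have key : (1 - q + q * (1 - g)) * (y / (1 - y)) ≤ q * g := by
      have e : (1 - q + q * (1 - g)) = 1 - q * g := by ring
      rw [e, mul_div_assoc', div_le_iff₀ h1y]
      nlinarith [hyqg]
    have hpL := hp (l + r + k)
    nlinarith [mul_le_mul_of_nonneg_left c0 t0, mul_le_mul_of_nonneg_left c1 t1, mul_le_mul_of_nonneg_right key hpL]
  nlinarith [mul_nonneg (sub_nonneg.2 hγ1.le) (neg_nonneg.2 hΨl), mul_nonneg hγ0.le (neg_nonneg.2 hΨh)]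

/-- **LEMMA W's pair condition when the low atom is self-sufficient for the glued piece** (`T ≤ 2l + m`, `m = q(r+kg)`; in particular whenever
`2(l+r) ≥ T`, since `2r < m`): then `Ψ(l) ≤ 0` and `Ψ(h) ≤ 0` (`gluedPullback_nonpos`), so `(1−γ)Ψ(l) + γΨ(h) ≤ 0` for every price system. [this work] -/
theorem gluedPullback_windowPair_selfSufficient (x a q g S : ℝ) (B r k j l h : ℕ) (α p : ℕ → ℝ)
    (hx0 : 0 < x) (hx1 : x < 1) (ha0 : 0 < a) (ha1 : a ≤ 1) (hq0 : 0 < q) (hq1 : q < 1) (hg0 : 0 ≤ g) (hg1 : g ≤ 1) (hr : 1 ≤ r)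
    (hxqg : x ≤ q * g) (hjM : j < B + (r + k)) (hlh : l < h) (hhB : h ≤ B) (hwin : j < h + r + k)
    (hlow : 2 * (l : ℝ) < a * S) (hlight : pairGate (a * x) (a * S) l h < a * x)
    (hself : a * (S + q * ((r : ℝ) + k * g)) ≤ 2 * (l : ℝ) + q * ((r : ℝ) + k * g))
    (hp : ∀ h, 0 ≤ p h)
    (hαp : ∀ l' h', l' ≤ j → 2 * (l' : ℝ) < a * (S + q * ((r : ℝ) + k * g)) → h' ≤ B + (r + k) →
      (j + 1 ≤ h' ∨ a * (S + q * ((r : ℝ) + k * g)) < (l' : ℝ) + h') →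
      α l' ≤ usage (a * x) (a * (S + q * ((r : ℝ) + k * g))) j l' h' * p h') :
    (1 - pairGate (a * x) (a * S) l h) * gluedPullback (a * (S + q * ((r : ℝ) + k * g))) q g j r k α p l
      + pairGate (a * x) (a * S) l h * gluedPullback (a * (S + q * ((r : ℝ) + k * g))) q g j r k α p h ≤ 0 := by
  set y : ℝ := a * x with hy
  set T : ℝ := a * (S + q * ((r : ℝ) + k * g)) with hT
  clear_value y T
  have hy0 : 0 < y := by rw [hy]; exact mul_pos ha0 hx0
  have hyx : y ≤ x := by rw [hy]; nlinarith
  have hy1 : y < 1 := by linarith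
  have hyqg : y ≤ q * g := le_trans hyx hxqg
  have haff : y * ((r : ℝ) + k) ≤ q * ((r : ℝ) + k * g) := by
    have h1 : q * g * ((r : ℝ) + k) ≤ q * ((r : ℝ) + k * g) := by
      have : q * g * (r : ℝ) ≤ q * r := by nlinarith [mul_le_mul_of_nonneg_left hg1 (mul_nonneg hq0.le (Nat.cast_nonneg r))]
      nlinarith
    nlinarith [mul_le_mul_of_nonneg_right hyqg (show (0:ℝ) ≤ (r : ℝ) + k by positivity)]
  have hγ0 : 0 < pairGate y (a * S) l h := pairGate_pos y (a * S) l h hlow hlh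
  have hγ1 : pairGate y (a * S) l h < 1 := lt_trans hlight hy1
  have hΨh : gluedPullback T q g j r k α p h ≤ 0 :=
    gluedPullback_nonpos y q g T r k j B h α p hy0 hy1 hq0 hq1.le hg0 hg1 hr hyqg haff hjM hhB (Or.inr hwin) hp hαp
  have hlB : l ≤ B := by omega
  have hΨl : gluedPullback T q g j r k α p l ≤ 0 :=
    gluedPullback_nonpos y q g T r k j B l α p hy0 hy1 hq0 hq1.le hg0 hg1 hr hyqg haff hjM hlB (Or.inl hself) hp hαp
  nlinarith [mul_nonneg (sub_nonneg.2 hγ1.le) (neg_nonneg.2 hΨl), mul_nonneg hγ0.le (neg_nonneg.2 hΨh)]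

end LawDec
end Quant
end Summit.CriticalPhenomena.PercolationContinuityZ3.Theorems
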